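import Mathlib
import HarnessLib
import Summits.ResolutionOfSingularities.ResolutionOfSingularities.Theorems.WildQuotientsWildQuotientResolutionS1aQhSymCover
import Summits.ResolutionOfSingularities.ResolutionOfSingularities.Theorems.WildQuotientsWildQuotientResolutionS1aQhAwayDatum

/-!
# S1a — R4c brick (i), localised: the two-moving-generator root read in `L = k[x][1/hh]` and in `k[x]` (σ-adaptedness, (H1), residual, iterates)

[OURS · L1 W4.5c · lead-1 g17; plan-1 RULING R-F15v, SPEC `Lines/s1a_logminvertex-R4c-SPEC.md` §1 (1O): instantiation of ✓`…S1aQhSymAbsRoot` at the localised node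
ring of an invariant basic open (pattern ✓`…S1aQhAwayDatum`): rows `σx₀ = x₀`, `σx₁ = x₁ + x₀`, `σx₂ = x₂ + x₀`, `σx₃ = x₃ + t₀`, weights `w` with
`w 1 + sh ≤ w 0 = w 2 + sh`, `t₀ ∈ 𝒥_sh` (the cusp: `w = (9, 2, 3)`, `sh = 6`, `t₀ = x₂² − x₁³`)] — NOT statements of the manuscript; counted 0; AI-level work, weaker
than expert review. Crux stmt-ResolutionOfSingularities-17941 `CyclicQuotientFourfolds`, line `s1a-logminvertex` v13 (`stub_reachLowerInFX`).

* `qsl_rows` — the rows of `τ = sigmaAway σ` on `x₀/1, x₁/1, x₂/1, x₃/1`;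
* `qs_poly_map_le`, `qsl_map_le` — σ-adaptedness on `k[x]` and on `L`;
* `qsl_residual` — (H1) `aug σ_R ≤ (s^sh)`, `u₀′ ∈ 𝔞`, `t̂ ∈ 𝔞` over `L`;
* `qsl_iterates` — `σ_Rˡ u₁′`, `σ_Rˡ u₂′` in closed form (for the norm cover elements ✓`qs_coverElement_eq`).
-/

set_option linter.dupNamespace false

noncomputable section

open Literature.AlgebraicGeometry.Resolution
open scoped LaurentPolynomial
open MvPolynomial
open Summit.ResolutionOfSingularities.ResolutionOfSingularities.Theorems.WildQuotientResolution.S1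
open Summit.ResolutionOfSingularities.ResolutionOfSingularities.Theorems.WildQuotientResolution.S1.CoarseChart
open Summit.ResolutionOfSingularities.ResolutionOfSingularities.Theorems.WildQuotientResolution.S1.NodeAway
open Summit.ResolutionOfSingularities.ResolutionOfSingularities.Theorems.WildQuotientResolution.S1.CentreAway
open Summit.ResolutionOfSingularities.ResolutionOfSingularities.Theorems.WildQuotientResolution.S1.GameFrame.GModel
open Summit.ResolutionOfSingularities.ResolutionOfSingularities.Theorems.WildQuotientResolution.S1.KillCert.QhAway

namespace Summit.ResolutionOfSingularities.ResolutionOfSingularities.Theorems.WildQuotientResolution.S1.KillCert.QhSym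

variable {k : Type} [Field k] (σ : (MvPolynomial (Fin 4) k) ≃+* (MvPolynomial (Fin 4) k)) (hC : ∀ a : k, σ (C a) = C a)
  (h0 : σ (X 0) = X 0) (h1 : σ (X 1) = X 1 + X 0) (h2 : σ (X 2) = X 2 + X 0) (t₀ : (MvPolynomial (Fin 4) k)) (h3 : σ (X 3) = X 3 + t₀)
  (w : Fin 3 → ℕ) (sh : ℕ) (hw1 : w 1 + sh ≤ w 0) (hw2 : w 0 = w 2 + sh)
  (ht₀ : t₀ ∈ (weightedFiltration (fun i => (X ((![0, 1, 2] : Fin 3 → Fin 4) i) : MvPolynomial (Fin 4) k)) w).ideal sh)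
  (hh : (MvPolynomial (Fin 4) k)) (hσh : σ hh = hh)

include h0 h1 h2 h3 in
/-- **The rows of `τ = sigmaAway σ`** on `x₀/1, x₁/1, x₂/1, x₃/1` (both tail coordinates moving). -/
theorem qsl_rows :
    (sigmaAway σ hσh) ((fun i => algebraMap (MvPolynomial (Fin 4) k) (Localization.Away hh) (X ((![0, 1, 2] : Fin 3 → Fin 4) i))) 0) = (fun i => algebraMap (MvPolynomial (Fin 4) k) (Localization.Away hh) (X ((![0, 1, 2] : Fin 3 → Fin 4) i))) 0 ∧ (sigmaAway σ hσh) ((fun i => algebraMap (MvPolynomial (Fin 4) k) (Localization.Away hh) (X ((![0, 1, 2] : Fin 3 → Fin 4) i))) 1) = (fun i => algebraMap (MvPolynomial (Fin 4) k) (Localization.Away hh) (X ((![0, 1, 2] : Fin 3 → Fin 4) i))) 1 + (fun i => algebraMap (MvPolynomial (Fin 4) k) (Localization.Away hh) (X ((![0, 1, 2] : Fin 3 → Fin 4) i))) 0 ∧ (sigmaAway σ hσh) ((fun i => algebraMap (MvPolynomial (Fin 4) k) (Localization.Away hh) (X ((![0, 1, 2] : Fin 3 → Fin 4) i))) 2)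 = (fun i => algebraMap (MvPolynomial (Fin 4) k) (Localization.Away hh) (X ((![0, 1, 2] : Fin 3 → Fin 4) i))) 2 + (fun i => algebraMap (MvPolynomial (Fin 4) k) (Localization.Away hh) (X ((![0, 1, 2] : Fin 3 → Fin 4) i))) 0 ∧
      (sigmaAway σ hσh) (algebraMap (MvPolynomial (Fin 4) k) (Localization.Away hh) (X 3 : (MvPolynomial (Fin 4) k))) = algebraMap (MvPolynomial (Fin 4) k) (Localization.Away hh) (X 3 : (MvPolynomial (Fin 4) k)) + algebraMap (MvPolynomial (Fin 4) k) (Localization.Away hh) t₀ := by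
  refine ⟨?_, ?_, ?_, ?_⟩
  · change (sigmaAway σ hσh) (algebraMap _ _ (X 0)) = algebraMap _ _ (X 0); rw [sigmaAway_algebraMap, h0]
  · change (sigmaAway σ hσh) (algebraMap _ _ (X 1)) = algebraMap _ _ (X 1) + algebraMap _ _ (X 0); rw [sigmaAway_algebraMap, h1, map_add]
  · change (sigmaAway σ hσh) (algebraMap _ _ (X 2)) = algebraMap _ _ (X 2) + algebraMap _ _ (X 0); rw [sigmaAway_algebraMap, h2, map_add]
  · rw [sigmaAway_algebraMap, h3, map_add]

include hC h0 h1 h2 h3 hw1 hw2 ht₀ in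
/-- σ-adaptedness of `𝒥(x₀,x₁,x₂; w)` on `k[x]`. -/
theorem qs_poly_map_le (n : ℕ) : ((weightedFiltration (fun i => (X ((![0, 1, 2] : Fin 3 → Fin 4) i) : MvPolynomial (Fin 4) k)) w).ideal n).map (σ : (MvPolynomial (Fin 4) k) →+* (MvPolynomial (Fin 4) k)) ≤ (weightedFiltration (fun i => (X ((![0, 1, 2] : Fin 3 → Fin 4) i) : MvPolynomial (Fin 4) k)) w).ideal n :=
  (qs_admissible_one σ (fun i => (X ((![0, 1, 2] : Fin 3 → Fin 4) i) : MvPolynomial (Fin 4) k)) (X 3) t₀ w sh (Set.range (C : k → (MvPolynomial (Fin 4) k))) h0 h1 h2 h3 (by rintro _ ⟨a, rfl⟩; exact hC a) poly_closure_eq_top hw1 hw2 ht₀).2 n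

include hC h0 h1 h2 h3 hw1 hw2 ht₀ in
/-- **σ-adaptedness over `L`**: `τ(𝒥ₙ(f; w)) ≤ 𝒥ₙ(f; w)`. -/
theorem qsl_map_le (n : ℕ) : ((weightedFiltration (fun i => algebraMap (MvPolynomial (Fin 4) k) (Localization.Away hh) (X ((![0, 1, 2] : Fin 3 → Fin 4) i))) w).ideal n).map ((sigmaAway σ hσh) : (Localization.Away hh) →+* (Localization.Away hh)) ≤ (weightedFiltration (fun i => algebraMap (MvPolynomial (Fin 4) k) (Localization.Away hh) (X ((![0, 1, 2] : Fin 3 → Fin 4) i))) w).ideal n :=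
  map_sigmaAway_weightedFiltration_le (fun i => (X ((![0, 1, 2] : Fin 3 → Fin 4) i) : MvPolynomial (Fin 4) k)) w σ hσh (qs_poly_map_le σ hC h0 h1 h2 t₀ h3 w sh hw1 hw2 ht₀) n

section Residual

variable {p : ℕ} (hp : 0 < p) (hσp : ∀ a : (MvPolynomial (Fin 4) k), (⇑σ)^[p] a = a)

set_option maxHeartbeats 1600000 in
include hC h0 h1 h2 h3 hw1 hw2 ht₀ in
/-- ★ **(H1) and the residual over `L`**: `aug σ_R ≤ (s^sh)`, `u₀′ ∈ 𝔞` (the `[x₀]`-chart is killed), `t̂ ∈ 𝔞`. [OURS · L1 W4.5c · R4c brick (i)] -/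
theorem qsl_residual (hσJ : ∀ n : ℕ, ((weightedFiltration (fun i => algebraMap (MvPolynomial (Fin 4) k) (Localization.Away hh) (X ((![0, 1, 2] : Fin 3 → Fin 4) i))) w).ideal n).map ((sigmaAway σ hσh) : (Localization.Away hh) →+* (Localization.Away hh)) ≤ (weightedFiltration (fun i => algebraMap (MvPolynomial (Fin 4) k) (Localization.Away hh) (X ((![0, 1, 2] : Fin 3 → Fin 4) i))) w).ideal n) :
    augmentationIdeal (sigmaR (sigmaAway σ hσh) (fun i => algebraMap (MvPolynomial (Fin 4) k) (Localization.Away hh) (X ((![0, 1, 2] : Fin 3 → Fin 4) i))) w hσJ hp (qhl_iterate σ hh hσh hσp)) ≤ Ideal.span {cobordantAlgebra.s (fun i => algebraMap (MvPolynomial (Fin 4) k) (Localization.Away hh) (X ((![0, 1, 2] : Fin 3 → Fin 4) i))) w ^ sh} ∧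
      cobordantAlgebra.u' (fun i => algebraMap (MvPolynomial (Fin 4) k) (Localization.Away hh) (X ((![0, 1, 2] : Fin 3 → Fin 4) i))) w 0 ∈ (augmentationIdeal (sigmaR (sigmaAway σ hσh) (fun i => algebraMap (MvPolynomial (Fin 4) k) (Localization.Away hh) (X ((![0, 1, 2] : Fin 3 → Fin 4) i))) w hσJ hp (qhl_iterate σ hh hσh hσp))).colon (Ideal.span {cobordantAlgebra.s (fun i => algebraMap (MvPolynomial (Fin 4) k) (Localization.Away hh) (X ((![0, 1, 2] : Fin 3 → Fin 4) i))) w ^ sh}) ∧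
      (⟨_, C_mul_T_mem_cobordantAlgebra _ _ (qhl_tail_mem t₀ w sh ht₀ hh)⟩ : ↥(cobordantAlgebra (fun i => algebraMap (MvPolynomial (Fin 4) k) (Localization.Away hh) (X ((![0, 1, 2] : Fin 3 → Fin 4) i))) w)) ∈ (augmentationIdeal (sigmaR (sigmaAway σ hσh) (fun i => algebraMap (MvPolynomial (Fin 4) k) (Localization.Away hh) (X ((![0, 1, 2] : Fin 3 → Fin 4) i))) w hσJ hp (qhl_iterate σ hh hσh hσp))).colon (Ideal.span {cobordantAlgebra.s (fun i => algebraMap (MvPolynomial (Fin 4) k) (Localization.Away hh) (X ((![0, 1, 2] : Fin 3 → Fin 4) i))) w ^ sh}) := by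
  obtain ⟨r0, r1, r2, r3⟩ := qsl_rows σ h0 h1 h2 t₀ h3 hh hσh
  exact qs_augmentationIdeal_le_and_residual (sigmaAway σ hσh) (fun i => algebraMap (MvPolynomial (Fin 4) k) (Localization.Away hh) (X ((![0, 1, 2] : Fin 3 → Fin 4) i))) (algebraMap (MvPolynomial (Fin 4) k) (Localization.Away hh) (X 3)) (algebraMap (MvPolynomial (Fin 4) k) (Localization.Away hh) t₀) w sh (({IsLocalization.Away.invSelf hh} ∪ Set.range (algebraMap k (Localization.Away hh))) : Set (Localization.Away hh)) r0 r1 r2 r3 (qhl_fix σ hC hh hσh)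
    (qhl_closure_eq_top hh) hw1 hw2 (qhl_tail_mem t₀ w sh ht₀ hh) hp (qhl_iterate σ hh hσh hσp) hσJ

include h0 h1 h2 hw1 hw2 in
/-- **The iterates of `σ_R` on the moving generators**, closed form (`u₁′ ↦ u₁′ + l·s^sh·(u₀′s^{w₀−w₁−sh})`, `u₂′ ↦ u₂′ + l·s^sh·u₀′`). -/
theorem qsl_iterates (hσJ : ∀ n : ℕ, ((weightedFiltration (fun i => algebraMap (MvPolynomial (Fin 4) k) (Localization.Away hh) (X ((![0, 1, 2] : Fin 3 → Fin 4) i))) w).ideal n).map ((sigmaAway σ hσh) : (Localization.Away hh) →+* (Localization.Away hh)) ≤ (weightedFiltration (fun i => algebraMap (MvPolynomial (Fin 4) k) (Localization.Away hh) (X ((![0, 1, 2] : Fin 3 → Fin 4) i))) w).ideal n) (l : ℕ) :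
    (⇑(sigmaR (sigmaAway σ hσh) (fun i => algebraMap (MvPolynomial (Fin 4) k) (Localization.Away hh) (X ((![0, 1, 2] : Fin 3 → Fin 4) i))) w hσJ hp (qhl_iterate σ hh hσh hσp)))^[l] (cobordantAlgebra.u' (fun i => algebraMap (MvPolynomial (Fin 4) k) (Localization.Away hh) (X ((![0, 1, 2] : Fin 3 → Fin 4) i))) w 1) =
        cobordantAlgebra.u' (fun i => algebraMap (MvPolynomial (Fin 4) k) (Localization.Away hh) (X ((![0, 1, 2] : Fin 3 → Fin 4) i))) w 1 + (l : ↥(cobordantAlgebra (fun i => algebraMap (MvPolynomial (Fin 4) k) (Localization.Away hh) (X ((![0, 1, 2] : Fin 3 → Fin 4) i))) w)) * (cobordantAlgebra.s (fun i => algebraMap (MvPolynomial (Fin 4) k) (Localization.Away hh) (X ((![0, 1, 2] : Fin 3 → Fin 4) i))) w ^ sh * (cobordantAlgebra.u' (fun i => algebraMap (MvPolynomial (Fin 4) k) (Localization.Away hh) (X ((![0, 1, 2] : Fin 3 → Fin 4) i))) w 0 * cobordantAlgebra.s (fun i => algebraMap (MvPolynomial (Fin 4) k) (Localization.Away hh)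 (X ((![0, 1, 2] : Fin 3 → Fin 4) i))) w ^ (w 0 - (w 1 + sh)))) ∧
      (⇑(sigmaR (sigmaAway σ hσh) (fun i => algebraMap (MvPolynomial (Fin 4) k) (Localization.Away hh) (X ((![0, 1, 2] : Fin 3 → Fin 4) i))) w hσJ hp (qhl_iterate σ hh hσh hσp)))^[l] (cobordantAlgebra.u' (fun i => algebraMap (MvPolynomial (Fin 4) k) (Localization.Away hh) (X ((![0, 1, 2] : Fin 3 → Fin 4) i))) w 2) = cobordantAlgebra.u' (fun i => algebraMap (MvPolynomial (Fin 4) k) (Localization.Away hh) (X ((![0, 1, 2] : Fin 3 → Fin 4) i))) w 2 + (l : ↥(cobordantAlgebra (fun i => algebraMap (MvPolynomial (Fin 4) k) (Localization.Away hh) (X ((![0, 1, 2] : Fin 3 → Fin 4) i))) w)) * (cobordantAlgebra.s (fun i => algebraMap (MvPolynomial (Fin 4) k) (Localization.Away hh) (X ((![0, 1, 2] : Fin 3 → Fin 4) i))) w ^ sh * cobordantAlgebra.u' (fun i => algebraMap (MvPolynomial (Fin 4) k) (Localization.Away hh) (X ((![0, 1, 2] : Fin 3 → Fin 4) i))) w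 0) := by
  have r0 : (sigmaAway σ hσh) ((fun i => algebraMap (MvPolynomial (Fin 4) k) (Localization.Away hh) (X ((![0, 1, 2] : Fin 3 → Fin 4) i))) 0) = (fun i => algebraMap (MvPolynomial (Fin 4) k) (Localization.Away hh) (X ((![0, 1, 2] : Fin 3 → Fin 4) i))) 0 := by change (sigmaAway σ hσh) (algebraMap _ _ (X 0)) = algebraMap _ _ (X 0); rw [sigmaAway_algebraMap, h0]
  have r1 : (sigmaAway σ hσh) ((fun i => algebraMap (MvPolynomial (Fin 4) k) (Localization.Away hh) (X ((![0, 1, 2] : Fin 3 → Fin 4) i))) 1) = (fun i => algebraMap (MvPolynomial (Fin 4) k) (Localization.Away hh) (X ((![0, 1, 2] : Fin 3 → Fin 4) i))) 1 + (fun i => algebraMap (MvPolynomial (Fin 4) k) (Localization.Away hh) (X ((![0, 1, 2] : Fin 3 → Fin 4) i))) 0 := by change (sigmaAway σ hσh) (algebraMap _ _ (X 1)) = algebraMap _ _ (X 1) + algebraMap _ _ (X 0); rw [sigmaAway_algebraMap, h1, map_add]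
  have r2 : (sigmaAway σ hσh) ((fun i => algebraMap (MvPolynomial (Fin 4) k) (Localization.Away hh) (X ((![0, 1, 2] : Fin 3 → Fin 4) i))) 2) = (fun i => algebraMap (MvPolynomial (Fin 4) k) (Localization.Away hh) (X ((![0, 1, 2] : Fin 3 → Fin 4) i))) 2 + (fun i => algebraMap (MvPolynomial (Fin 4) k) (Localization.Away hh) (X ((![0, 1, 2] : Fin 3 → Fin 4) i))) 0 := by change (sigmaAway σ hσh) (algebraMap _ _ (X 2)) = algebraMap _ _ (X 2) + algebraMap _ _ (X 0); rw [sigmaAway_algebraMap, h2, map_add]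
  exact ⟨qs_sigmaR_iterate_u'_one (sigmaAway σ hσh) (fun i => algebraMap (MvPolynomial (Fin 4) k) (Localization.Away hh) (X ((![0, 1, 2] : Fin 3 → Fin 4) i))) w sh r0 r1 hw1 hp (qhl_iterate σ hh hσh hσp) hσJ l,
    qs_sigmaR_iterate_u'_two (sigmaAway σ hσh) (fun i => algebraMap (MvPolynomial (Fin 4) k) (Localization.Away hh) (X ((![0, 1, 2] : Fin 3 → Fin 4) i))) w sh r0 r2 hw2 hp (qhl_iterate σ hh hσh hσp) hσJ l⟩

end Residual

end Summit.ResolutionOfSingularities.ResolutionOfSingularities.Theorems.WildQuotientResolution.S1.KillCert.QhSym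

end
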